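import HarnessLib
import Summits.ValiantsHypothesis.ValiantsHypothesis.Theorems.Depth4BoundedDoor

/-!
# Depth4WidthDoor — the composition-width door (O27, lens-4 g34)

A NEW OBJECT on the chasm axis: the WIDTH of a balanced composition.  `f` FACTORS THROUGH WIDTH
`q` AT DEGREES `(D, t)` when `f = F(Q₁, …, Q_q)`, `deg F ≤ D`, `deg Qᵢ ≤ t` (inline, no `Prop`:
`∃ Q F, (∀ i, (Q i).totalDegree ≤ t) ∧ F.totalDegree ≤ D ∧ aeval Q F = f`), i.e. `f` lies in
the degree-`≤ D` part of the subalgebra `K[Q₁, …, Q_q]`; no circuit, no fan-in, no sparsity —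
`F` and the `Qᵢ` may be arbitrarily hard.  The cell (one dial `c`, balanced degrees):
  `WidthDoor := ∀ c, ∃ n, per_n does NOT factor through width (n+2)^c at (c⌊√n⌋+c, ⌊√n⌋)`.
LABEL (critic decomp-val-crit-1 g9, CALL O27): SUFFICIENT cell in a NEW currency (subalgebra
width at balanced degrees) · WEAKER-or-equal than BoundedDoor ⟸ 11333 (strictness UNDECIDED,
twice) · arrows KNOWN-in-spirit, kernel-new · door not found in print · NEW-COMBINATION (upper
boundary) · NOT a rung · 0 S-currency · leaf IDEA-NEEDED under a stated METHOD CEILING · closes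
no item · VP ≠ VNP is NOT proved and is untouched.
ARROWS (all kernel, all here): STRUCTURED TAVENAS — the Agrawal–Vinay–Tavenas expansion is a
COMPOSITION whose letters are the ATOMS `[ν]`, `[ν:μ]` (`HomCircuit.aval`), so ONE alphabet of
`S + S²` polynomials of degree `≤ t` serves every node and every homogeneous component, with
expansion polynomial of degree `≤ 1 + 4⌊8d/(t+1)⌋`; hence (★`exists_comp_of_isVPFamily`) a VP
family factors through POLYNOMIAL width `(n+2)^a` at `(a⌊d/t⌋ + a, t)` for EVERY `t ≥ 1`, `a`
independent of `t`, no homogeneity hypothesis.  SUFFICIENT: ★`valiantsHypothesis_of_widthDoor`.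
BELOW THE BOUNDED DOOR: `hasSPSPExpr_of_comp` (expand `F` into `≤ (D+1)(q+D)^D` monomials) gives
★`widthDoor_of_boundedDoor` and `widthDoor_of_depth4HomFour`, so `Depth4HomFour (11333) ⟹
BoundedDoor ⟹ WidthDoor ⟹ VP ≠ VNP`; converses NOT claimed (a door-sized expression may carry
`n^{O(√n)}` DISTINCT bottom polynomials; width counts each ONCE), strictness UNDECIDED.
NON-VACUITY of the `∃ n` binder: `per_0 = 1 = aeval Q (C 1)` factors through every width at every
`c`, so `n = 0` is NEVER a witness; at `c = 0` the witness is `n = 1` (`F` constant, `per_1` not).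
FLOOR IN PRINT (not typed): Agrawal–Saha–Saptharishi–Saxena, SICOMP 2016 Thm 1.7 (= arXiv
1111.0582 Thm 1.5): `C` ANY circuit, `f₁…f_m` of sparsity `≤ s`, trdeg `≤ r`, `C(f) = Imm_n` (ANY
immanant) ⟹ `s = 2^{Ω(n/r)}`; so `width ≥ Ω(√n/log n)` for per AND det, `D`-insensitive — not
per-specific.  METHOD CEILING: every `D`-insensitive invariant of the alphabet (trdeg, strength,
rank) is `≤ n²` (`per_n ∈ K[x_ij]`), the door asks `> (n+2)^c ∀ c` at `D = c√n + c < n`: leaf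
IDEA-NEEDED (a `D`-SENSITIVE generator count), window `[Ω(√n/log n), n^{ω(1)})`; door FALSE for
det on paper.  0 S-currency (VP ≠ VNP ⇏ WidthDoor); NOT a rung; VP ≠ VNP is NOT proved.
-/

set_option linter.dupNamespace false

namespace Summit.ValiantsHypothesis.ValiantsHypothesis.Theorems.Depth4WidthDoor

open MvPolynomial Literature.Computability.AlgebraicComplexity

/-- Monotonicity of factoring through width: pad the alphabet with zeros (`rename` along
`Fin.castLE`), relax the two degree bounds. [folklore] -/
theorem comp_mono {K : Type*} [CommSemiring K] {σ : Type*} {f : MvPolynomial σ K}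
    {q q' D D' t t' : ℕ}
    (h : ∃ (Q : Fin q → MvPolynomial σ K) (F : MvPolynomial (Fin q) K),
      (∀ i, (Q i).totalDegree ≤ t) ∧ F.totalDegree ≤ D ∧ aeval Q F = f)
    (hq : q ≤ q') (hD : D ≤ D') (ht : t ≤ t') :
    ∃ (Q : Fin q' → MvPolynomial σ K) (F : MvPolynomial (Fin q') K),
      (∀ i, (Q i).totalDegree ≤ t') ∧ F.totalDegree ≤ D' ∧ aeval Q F = f := by
  obtain ⟨Q, F, hQ, hF, hf⟩ := h
  refine ⟨fun i => if hi : (i : ℕ) < q then Q ⟨i, hi⟩ else 0, rename (Fin.castLE hq) F,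
    fun i => ?_, (totalDegree_rename_le _ _).trans (hF.trans hD), ?_⟩
  · dsimp only
    split_ifs
    · exact (hQ _).trans ht
    · rw [totalDegree_zero]; exact Nat.zero_le _
  · have hc : ((fun i : Fin q' => if hi : (i : ℕ) < q then Q ⟨i, hi⟩ else 0) ∘ Fin.castLE hq)
        = Q := by
      funext i
      simp only [Function.comp_apply]
      rw [dif_pos (show ((Fin.castLE hq i : Fin q') : ℕ) < q from i.isLt)]
      try exact congrArg Q (Fin.ext rfl)
    rw [aeval_rename, hc, hf]

/-- **Structured Tavenas, certificate level.**  For a homogeneous circuit certificate on a finite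
node type of cardinality `S` and a threshold `t ≥ 1`, ONE alphabet of `S + S²` polynomials of
total degree `≤ t` (the values of the small atoms `[ν]`, `[ν:μ]`; big atoms ↦ `0`) serves every
node: `val ν = F_ν(alphabet)` with `deg F_ν ≤ 1 + 4⌊8·deg ν/(t+1)⌋` (`F_ν = Σ_T Π_{a∈T} y_a` over
the final expansion `expand t ν R`). [cite: Tavenas2015, Thm. 1 and Lemma 3; AgrawalVinay2008] -/
theorem exists_comp_of_homCircuit {k : Type*} [CommSemiring k] {σ : Type*} {ι : Type*}
    [Fintype ι] [DecidableEq ι] (H : DepthReduction.HomCircuit k σ ι) {t : ℕ} (ht : 1 ≤ t) :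
    ∃ Q : Fin (Fintype.card ι + Fintype.card ι * Fintype.card ι) → MvPolynomial σ k,
      (∀ i, (Q i).totalDegree ≤ t) ∧
      ∀ ν : ι, ∃ F : MvPolynomial (Fin (Fintype.card ι + Fintype.card ι * Fintype.card ι)) k,
        F.totalDegree ≤ 1 + 4 * (8 * H.deg ν / (t + 1)) ∧ aeval Q F = H.val ν := by
  classical
  have e0 : DepthReduction.HomCircuit.Atom ι ≃ ι ⊕ ι × ι :=
    { toFun := fun a => match a with
        | .node ν => Sum.inl ν
        | .quot ν μ => Sum.inr (ν, μ)
      invFun := fun x => match x with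
        | Sum.inl ν => .node ν
        | Sum.inr p => .quot p.1 p.2
      left_inv := fun a => by cases a <;> rfl
      right_inv := fun x => by rcases x with ν | ⟨ν, μ⟩ <;> rfl }
  obtain ⟨e⟩ : Nonempty (DepthReduction.HomCircuit.Atom ι ≃
      Fin (Fintype.card ι + Fintype.card ι * Fintype.card ι)) :=
    ⟨e0.trans (Fintype.equivFinOfCardEq (by rw [Fintype.card_sum, Fintype.card_prod]))⟩
  refine ⟨fun i => if H.adeg (e.symm i) ≤ t then H.aval (e.symm i) else 0, fun i => ?_,
    fun ν => ?_⟩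
  · dsimp only
    split_ifs with h
    · exact (H.totalDegree_aval_le _).trans h
    · rw [totalDegree_zero]; exact Nat.zero_le _
  · haveI : Nonempty ι := ⟨ν⟩
    have hinv := H.inv_expand ht ν (8 * H.deg ν / (t + 1))
    have hfin := H.final_expand ht ν
    refine ⟨rename e (((H.expand t ν (8 * H.deg ν / (t + 1))).map
      fun T => (T.map (X (R := k))).prod).sum), ?_, ?_⟩
    · refine (totalDegree_rename_le _ _).trans
        (DepthReduction.totalDegree_list_sum_le fun p hp => ?_)
      obtain ⟨T, hT, rfl⟩ := List.mem_map.1 hp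
      refine (totalDegree_list_prod _).trans ?_
      rw [List.map_map]
      refine (List.sum_le_card_nsmul _ 1 fun x hx => ?_).trans ?_
      · obtain ⟨a, -, rfl⟩ := List.mem_map.1 hx
        exact DepthReduction.totalDegree_X_le _
      · rw [List.length_map, smul_eq_mul, mul_one]; exact hinv.length_le T hT
    · rw [aeval_rename, map_list_sum, List.map_map, ← hinv.sum_eq]
      congr 1
      refine List.map_congr_left fun T hT => ?_
      simp only [Function.comp_apply, map_list_prod, List.map_map]
      show _ = (T.map H.aval).prod
      congr 1
      refine List.map_congr_left fun a ha => ?_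
      simp only [Function.comp_apply, aeval_X, Equiv.symm_apply_apply]
      rw [if_pos (hfin T hT a ha)]

/-- **Structured Tavenas, straight-line programs.**  A value of total degree `≤ d` of a
straight-line program of length `L` factors through width `S + S²`, `S = 4L(d+1)²`, at degrees
`(1 + 4⌊8d/(t+1)⌋, t)`, for every `t ≥ 1` (homogenise; ONE alphabet for all `d+1` components).
[cite: Tavenas2015, Thm. 1 and Prop. 2; AgrawalVinay2008] -/
theorem exists_comp_of_slp {k : Type*} [CommSemiring k] {σ : Type*}
    (P : DepthReduction.SLP k σ) {d t : ℕ} (ht : 1 ≤ t) {i : ℕ} (hi : i < P.len)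
    (hd : (P.val i).totalDegree ≤ d) :
    ∃ (Q : Fin (4 * P.len * (d + 1) ^ 2 + (4 * P.len * (d + 1) ^ 2) * (4 * P.len * (d + 1) ^ 2))
        → MvPolynomial σ k)
      (F : MvPolynomial
        (Fin (4 * P.len * (d + 1) ^ 2 + (4 * P.len * (d + 1) ^ 2) * (4 * P.len * (d + 1) ^ 2))) k),
      (∀ j, (Q j).totalDegree ≤ t) ∧ F.totalDegree ≤ 1 + 4 * (8 * d / (t + 1)) ∧
        aeval Q F = P.val i := by
  classical
  obtain ⟨Q, hQ, hF⟩ := exists_comp_of_homCircuit (P.homogenize d) ht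
  choose F hFdeg hFval using fun e : Fin (d + 1) => hF (⟨i, hi⟩, DepthReduction.SLP.Tag.Q e)
  have hval_e : ∀ e : Fin (d + 1), (P.homogenize d).val (⟨i, hi⟩, DepthReduction.SLP.Tag.Q e) =
      homogeneousComponent (e : ℕ) (P.val i) := fun e => rfl
  refine comp_mono ⟨Q, ∑ e : Fin (d + 1), F e, hQ, ?_, ?_⟩
    (Nat.add_le_add (P.card_node_le d) (Nat.mul_le_mul (P.card_node_le d) (P.card_node_le d)))
    le_rfl le_rfl
  · refine (totalDegree_finsetSum _ _).trans (Finset.sup_le fun e _ => (hFdeg e).trans ?_)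
    show 1 + 4 * (8 * (e : ℕ) / (t + 1)) ≤ 1 + 4 * (8 * d / (t + 1))
    have := e.isLt
    gcongr
    omega
  · rw [map_sum]
    simp only [hFval, hval_e]
    rw [Fin.sum_univ_eq_sum_range (fun e => homogeneousComponent e (P.val i)) (d + 1)]
    exact DepthReduction.sum_homogeneousComponent_of_le hd

/-- **Structured Tavenas for VP families** (any commutative semiring, no homogeneity needed): a
`VP` family factors through POLYNOMIAL width `(n+2)^a` at degrees `(a⌊dₙ/t⌋ + a, t)` for EVERY
`t ≥ 1` (`dₙ = deg fₙ`), `a` independent of `t`.  VP-side content of the width door only: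
NOT a rung, 0 S-currency, strictness UNDECIDED and the IDEA-NEEDED leaf untouched;
VP ≠ VNP is NOT proved. [cite: Tavenas2015, Thm. 1; AgrawalVinay2008] -/
theorem exists_comp_of_isVPFamily {K : Type*} [CommSemiring K] {σ : ℕ → Type*}
    [∀ n, Fintype (σ n)] (f : ∀ n, MvPolynomial (σ n) K) (hf : IsVPFamily f) :
    ∃ a : ℕ, ∀ n t : ℕ, 1 ≤ t →
      ∃ (Q : Fin ((n + 2) ^ a) → MvPolynomial (σ n) K) (F : MvPolynomial (Fin ((n + 2) ^ a)) K),
        (∀ i, (Q i).totalDegree ≤ t) ∧ F.totalDegree ≤ a * ((f n).totalDegree / t) + a ∧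
          aeval Q F = f n := by
  classical
  obtain ⟨⟨⟨a1, h1⟩, ⟨a2, h2⟩⟩, ⟨a3, h3⟩⟩ := hf
  set a := a1 + a2 + a3 with ha
  set E := a + 2 with hE
  refine ⟨6 * E + 40, fun n t ht => ?_⟩
  set A := 6 * E + 40 with hA
  set B := n + 2 with hB
  set g := f n
  set d := g.totalDegree with hd
  have hB2 : 2 ≤ B := by rw [hB]; omega
  have hA1 : 1 ≤ A := by rw [hA]; omega
  have hAD : 1 ≤ A * (d / t) + A := hA1.trans (Nat.le_add_left A _)
  have hBA : 1 ≤ B ^ A := Nat.one_le_pow _ _ (by omega)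
  have hone : ∀ q : MvPolynomial (σ n) K, q.totalDegree ≤ t →
      ∃ (Q : Fin (B ^ A) → MvPolynomial (σ n) K) (F : MvPolynomial (Fin (B ^ A)) K),
        (∀ i, (Q i).totalDegree ≤ t) ∧ F.totalDegree ≤ A * (d / t) + A ∧ aeval Q F = q := by
    intro q hq
    refine comp_mono (q := 1) (D := 1) ⟨fun _ => q, X 0, fun _ => hq,
      DepthReduction.totalDegree_X_le _, aeval_X _ _⟩ hBA hAD le_rfl
  obtain ⟨P, hfan, hcomp, hsize⟩ := ArithCircuit.exists_computes_size_eq_complexity g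
  obtain ⟨S, hlen, hcases⟩ := DepthReduction.exists_slp P hfan
  rw [show P.eval = g from hcomp] at hcases
  rcases hcases with ⟨i, hi, hgi⟩ | ⟨j, hgj⟩ | ⟨c, hgc⟩
  · obtain ⟨Q, F, hQ, hF, hv⟩ := exists_comp_of_slp S (d := d) ht hi (le_of_eq (by rw [← hgi]))
    rw [← hgi] at hv
    have h4 := DepthReduction.four_mul_pow_le B a hB2
    have hBa : 1 ≤ B ^ a := Nat.one_le_pow _ _ (by omega)
    have hdd : d ≤ 2 * B ^ a := DepthReduction.le_two_mul_pow (h2 n) (by omega)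
    have hss : S.len ≤ 2 * B ^ a := by
      rw [hlen, hsize]; exact DepthReduction.le_two_mul_pow (h3 n) (by omega)
    have hd1 : d + 1 ≤ B ^ E := by rw [hE]; omega
    have hsE : S.len ≤ B ^ E := by rw [hE]; omega
    have hS1 : 4 * S.len * (d + 1) ^ 2 ≤ B ^ (3 * E + 2) :=
      calc 4 * S.len * (d + 1) ^ 2 ≤ 4 * B ^ E * (B ^ E) ^ 2 :=
            Nat.mul_le_mul (Nat.mul_le_mul_left 4 hsE) (Nat.pow_le_pow_left hd1 2)
        _ = 4 * B ^ (3 * E) := by ring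
        _ ≤ B ^ (3 * E + 2) := DepthReduction.four_mul_pow_le B _ hB2
    have hS2 : (4 * S.len * (d + 1) ^ 2) * (4 * S.len * (d + 1) ^ 2) ≤ B ^ (6 * E + 4) :=
      calc _ ≤ B ^ (3 * E + 2) * B ^ (3 * E + 2) := Nat.mul_le_mul hS1 hS1
        _ = B ^ (6 * E + 4) := by
          rw [← pow_add, show 3 * E + 2 + (3 * E + 2) = 6 * E + 4 by omega]
    refine comp_mono ⟨Q, F, hQ, hF, hv⟩ ?_ ?_ le_rfl
    · calc _ ≤ B ^ (3 * E + 2) + B ^ (6 * E + 4) := Nat.add_le_add hS1 hS2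
        _ ≤ B ^ (6 * E + 4) + B ^ (6 * E + 4) :=
          Nat.add_le_add_right (Nat.pow_le_pow_right (by omega) (by omega)) _
        _ = 2 * B ^ (6 * E + 4) := by ring
        _ ≤ B * B ^ (6 * E + 4) := Nat.mul_le_mul_right _ hB2
        _ = B ^ (6 * E + 5) := by ring
        _ ≤ B ^ A := Nat.pow_le_pow_right (by omega) (by rw [hA]; omega)
    · have hlt : 8 * d / t < 8 * (d / t) + 8 := by
        rw [Nat.div_lt_iff_lt_mul (by omega)]
        have := Nat.lt_div_mul_add (a := d) (show 0 < t by omega)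
        nlinarith
      have hle : 8 * d / (t + 1) ≤ 8 * d / t := Nat.div_le_div_left (by omega) (by omega)
      have h32 : 32 * (d / t) ≤ A * (d / t) := Nat.mul_le_mul_right _ (by rw [hA]; omega)
      omega
  · rw [hgj]; exact hone (X j) ((DepthReduction.totalDegree_X_le j).trans ht)
  · rw [hgc]; exact hone (C c) (by rw [totalDegree_C]; exact Nat.zero_le _)

/-- The permanent instance at the balanced degree `t = ⌊√n⌋`: IF `per ∈ VP` then `per_n` factors
through width `(n+2)^a` at degrees `(a⌊√n⌋ + a, ⌊√n⌋)` (`deg per_n = n`, `⌊n/⌊√n⌋⌋ ≤ ⌊√n⌋ + 2`).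
[cite: Tavenas2015, Thm. 1; Landsberg2017, Thm. 7.5.2.1] -/
theorem exists_comp_perPoly_of_isVPFamily (K : Type*) [CommSemiring K] [Nontrivial K]
    (hper : IsVPFamily (fun n => perPoly (Fin n) K)) :
    ∃ a : ℕ, ∀ n : ℕ,
      ∃ (Q : Fin ((n + 2) ^ a) → MvPolynomial (Fin n × Fin n) K)
        (F : MvPolynomial (Fin ((n + 2) ^ a)) K),
        (∀ i, (Q i).totalDegree ≤ Nat.sqrt n) ∧ F.totalDegree ≤ a * Nat.sqrt n + a ∧
          aeval Q F = perPoly (Fin n) K := by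
  classical
  have hdeg : ∀ n : ℕ, (perPoly (Fin n) K).totalDegree = n := fun n => by
    rw [totalDegree_perPoly_holds (n := Fin n) (k := K), Fintype.card_fin]
  obtain ⟨a, ha⟩ := exists_comp_of_isVPFamily (fun n => perPoly (Fin n) K) hper
  refine ⟨3 * a, fun n => ?_⟩
  rcases Nat.eq_zero_or_pos n with rfl | hn
  · have h0 : (perPoly (Fin 0) K).totalDegree = 0 := hdeg 0
    rw [totalDegree_eq_zero_iff_eq_C] at h0
    refine ⟨fun _ => 0, C ((perPoly (Fin 0) K).coeff 0), fun _ => ?_, ?_, ?_⟩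
    · rw [totalDegree_zero]; exact Nat.zero_le _
    · rw [totalDegree_C]; exact Nat.zero_le _
    · rw [aeval_C, algebraMap_eq]; exact h0.symm
  · set s := Nat.sqrt n with hs
    have hs1 : 1 ≤ s := by rw [hs, Nat.le_sqrt]; omega
    obtain ⟨Q, F, hQ, hF, hv⟩ := ha n s hs1
    rw [hdeg n] at hF
    have h1 : n < (s + 1) * (s + 1) := Nat.lt_succ_sqrt n
    have hns : n / s ≤ s + 2 := Nat.div_le_of_le_mul (by nlinarith [h1])
    refine comp_mono ⟨Q, F, hQ, hF, hv⟩ (Nat.pow_le_pow_right (by omega) (by omega)) ?_ le_rfl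
    calc a * (n / s) + a ≤ a * (s + 2) + a := Nat.add_le_add_right (Nat.mul_le_mul_left a hns) a
      _ ≤ 3 * a * s + 3 * a := by nlinarith [Nat.zero_le (a * s)]

/-- **The width door yields the summit.**  If for every `c` some `per_n` does NOT factor through
width `(n+2)^c` at degrees `(c⌊√n⌋+c, ⌊√n⌋)` — `per_n ∉ ℂ[Q₁,…,Q_q]_{≤ c√n+c}` for any
`q ≤ (n+2)^c` forms of degree `≤ √n` — then `VP ≠ VNP` (structured Tavenas for `per ∈ VP`).
SUFFICIENT cell below the bounded door (converse NOT claimed, strictness UNDECIDED); 0 S-currency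
(VP ≠ VNP ⇏ WidthDoor); NOT a rung; leaf IDEA-NEEDED (floor in print ASSS 2016 Thm 1.7, `width ≥
Ω(√n/log n)` for ANY immanant; METHOD CEILING `n²`); settles nothing: VP ≠ VNP is NOT proved.
[cite: Tavenas2015, Thm. 1; AgrawalEtAl2011, Thm. 1.7 (SICOMP) = arXiv:1111.0582 Thm. 1.5] -/
theorem valiantsHypothesis_of_widthDoor
    (h : ∀ c : ℕ, ∃ n : ℕ, ¬ ∃ (Q : Fin ((n + 2) ^ c) → MvPolynomial (Fin n × Fin n) ℂ)
        (F : MvPolynomial (Fin ((n + 2) ^ c)) ℂ),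
        (∀ i, (Q i).totalDegree ≤ Nat.sqrt n) ∧ F.totalDegree ≤ c * Nat.sqrt n + c ∧
          aeval Q F = perPoly (Fin n) ℂ) :
    _root_.ValiantsHypothesis := by
  show Literature.Computability.AlgebraicComplexity.VP ℂ ≠
    Literature.Computability.AlgebraicComplexity.VNP ℂ
  intro hEq
  have hVNP := perFamily_mem_VNP_holds ℂ
  have hVP : perFamily ℂ ∈ VP ℂ := by rw [hEq]; exact hVNP
  have hfam : IsVPFamily (fun n => perPoly (Fin n) ℂ) := (mem_VP_ofFintype_iff_holds _).1 hVP
  obtain ⟨a, ha⟩ := exists_comp_perPoly_of_isVPFamily ℂ hfam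
  obtain ⟨n, hn⟩ := h a
  exact hn (ha n)

/-- A composition of width `q` at degrees `(D, t)`, `D ≥ 1`, IS a `ΣΠ^{[D]}ΣΠ^{[t]}` expression of
top fan-in `(D+1)(q+D)^D`: expand `F` into its `≤ (D+1)(q+D)^D` monomials
(`DepthReduction.card_le_of_degree_le`), each a product of `≤ D` letters padded with `1`, the
coefficient absorbed into the first factor. [cite: GuptaKamathKayalSaptharishi2014, §2] -/
theorem hasSPSPExpr_of_comp {K : Type*} [CommSemiring K] {σ : Type*} {f : MvPolynomial σ K}
    {q D t : ℕ} (hD : 1 ≤ D)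
    (h : ∃ (Q : Fin q → MvPolynomial σ K) (F : MvPolynomial (Fin q) K),
      (∀ i, (Q i).totalDegree ≤ t) ∧ F.totalDegree ≤ D ∧ aeval Q F = f) :
    HasSPSPExpr f ((D + 1) * (q + D) ^ D) D t := by
  classical
  obtain ⟨Q, F, hQ, hF, rfl⟩ := h
  set g : (Fin q →₀ ℕ) → Fin D → MvPolynomial σ K := fun m j =>
    (if j = (⟨0, hD⟩ : Fin D) then C (coeff m F) else 1) *
      ((Finsupp.toMultiset m).toList.map Q).getD (j : ℕ) 1 with hg
  have hgdeg : ∀ m j, (g m j).totalDegree ≤ t := by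
    intro m j
    refine (totalDegree_mul _ _).trans ?_
    have h1 : (if j = (⟨0, hD⟩ : Fin D) then C (coeff m F) else (1 : MvPolynomial σ K)).totalDegree
        = 0 := by split_ifs <;> simp only [totalDegree_C, totalDegree_one]
    rw [h1, zero_add]
    rcases DepthReduction.getD_one_mem_or ((Finsupp.toMultiset m).toList.map Q) j with hm | h1
    · obtain ⟨i, -, hi⟩ := List.mem_map.1 hm
      rw [← hi]; exact hQ i
    · rw [h1, totalDegree_one]; exact Nat.zero_le _
  have hterm : ∀ m ∈ F.support, ∏ j : Fin D, g m j = aeval Q (monomial m (coeff m F)) := by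
    intro m hm
    have hlen : ((Finsupp.toMultiset m).toList.map Q).length ≤ D := by
      rw [List.length_map, Multiset.length_toList, Finsupp.card_toMultiset]
      exact (le_totalDegree hm).trans hF
    simp only [hg, Finset.prod_mul_distrib, Finset.prod_ite_eq', Finset.mem_univ, if_true]
    rw [DepthReduction.prod_getD_one _ D hlen, Multiset.prod_map_toList, Finsupp.toMultiset_map,
      Finsupp.prod_toMultiset, Finsupp.prod_mapDomain_index (fun _ => pow_zero _)
        (fun _ _ _ => pow_add _ _ _), aeval_monomial, algebraMap_eq]
  have hU : F.support.card ≤ (D + 1) * (q + D) ^ D := by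
    have := DepthReduction.card_le_of_degree_le F.support hD
      fun m hm => (le_totalDegree hm).trans hF
    simpa only [Fintype.card_fin] using this
  have e : F.support ≃ Fin F.support.card := Fintype.equivFinOfCardEq (Fintype.card_coe _)
  have h0 : HasSPSPExpr (aeval Q F) F.support.card D t := by
    refine ⟨fun i j => g (e.symm i) j, fun i j => hgdeg _ _, ?_⟩
    calc aeval Q F = ∑ m ∈ F.support, aeval Q (monomial m (coeff m F)) := by
          conv_lhs => rw [F.as_sum]
          rw [map_sum]
      _ = ∑ m ∈ F.support, ∏ j : Fin D, g m j :=
          Finset.sum_congr rfl fun m hm => (hterm m hm).symm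
      _ = ∑ x : F.support, ∏ j : Fin D, g x j := (Finset.sum_coe_sort _ _).symm
      _ = ∑ i : Fin F.support.card, ∏ j : Fin D, g (e.symm i) j :=
          (e.symm.sum_comp (fun x => ∏ j : Fin D, g x j)).symm
  exact Depth4BoundedDoor.hasSPSPExpr_mono h0 hU le_rfl hD le_rfl

/-- **The width door lies below the bounded door** (any nontrivial commutative semiring):
`BoundedDoor ⟹ WidthDoor`, via `hasSPSPExpr_of_comp` and the padding `c ↦ c² + 3c + 1`
(`(D+1)(q+D)^D ≤ (n+2)^((c²+2c)⌊√n⌋ + c²+3c+1)` at `q = (n+2)^c`, `D = c⌊√n⌋+c`; `c = 0`: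
`per_1` is not constant).  Converse NOT claimed (width forgets the top fan-in),
strictness UNDECIDED; WidthDoor is the weaker-or-equal SUFFICIENT cell — NOT a rung, 0 S-currency,
leaf IDEA-NEEDED; VP ≠ VNP is NOT proved. [cite: GuptaKamathKayalSaptharishi2014, §2] -/
theorem widthDoor_of_boundedDoor (K : Type*) [CommSemiring K] [Nontrivial K]
    (h : ∀ c : ℕ, ∃ n : ℕ, ¬ HasSPSPExpr (perPoly (Fin n) K) ((n + 2) ^ (c * Nat.sqrt n + c))
      (c * Nat.sqrt n + c) (Nat.sqrt n)) :
    ∀ c : ℕ, ∃ n : ℕ, ¬ ∃ (Q : Fin ((n + 2) ^ c) → MvPolynomial (Fin n × Fin n) K)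
        (F : MvPolynomial (Fin ((n + 2) ^ c)) K),
        (∀ i, (Q i).totalDegree ≤ Nat.sqrt n) ∧ F.totalDegree ≤ c * Nat.sqrt n + c ∧
          aeval Q F = perPoly (Fin n) K := by
  classical
  intro c
  rcases Nat.eq_zero_or_pos c with rfl | hc
  · refine ⟨1, ?_⟩
    rintro ⟨Q, F, -, hF, hv⟩
    have hF0 : F.totalDegree = 0 := by omega
    rw [totalDegree_eq_zero_iff_eq_C] at hF0
    have hdeg : (perPoly (Fin 1) K).totalDegree = 1 := by
      rw [totalDegree_perPoly_holds (n := Fin 1) (k := K), Fintype.card_fin]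
    rw [← hv, hF0, aeval_C, algebraMap_eq, totalDegree_C] at hdeg
    omega
  · obtain ⟨n, hn⟩ := h (c * c + 3 * c + 1)
    refine ⟨n, fun hcomp => hn ?_⟩
    set c' := c * c + 3 * c + 1 with hc'
    set B := n + 2 with hB
    set s := Nat.sqrt n with hs
    set D := c * s + c with hDdef
    have hB2 : 2 ≤ B := by rw [hB]; omega
    have hD1 : 1 ≤ D := by rw [hDdef]; omega
    have hcB : c ≤ B ^ c := (Nat.lt_two_pow_self).le.trans (Nat.pow_le_pow_left hB2 c)
    have hD1B : D + 1 ≤ B ^ (c + 1) :=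
      calc D + 1 ≤ c * B := by rw [hDdef, hB]; nlinarith [(Nat.sqrt_le_self n : s ≤ n)]
        _ ≤ B ^ c * B := Nat.mul_le_mul_right B hcB
        _ = B ^ (c + 1) := (pow_succ B c).symm
    have hqD : B ^ c + D ≤ B ^ (c + 2) :=
      calc B ^ c + D ≤ B ^ (c + 1) + B ^ (c + 1) :=
            Nat.add_le_add (Nat.pow_le_pow_right (by omega) (by omega)) (by omega)
        _ = 2 * B ^ (c + 1) := by ring
        _ ≤ B * B ^ (c + 1) := Nat.mul_le_mul_right _ hB2
        _ = B ^ (c + 2) := by ring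
    have hexp : (c + 1) + (c + 2) * D ≤ c' * s + c' := by
      have : c' * s + c' = ((c + 1) + (c + 2) * D) + (c * s + s) := by rw [hc', hDdef]; ring
      omega
    have hDle : D ≤ c' * s + c' := by
      have : D ≤ (c + 2) * D := Nat.le_mul_of_pos_left D (by omega)
      omega
    refine Depth4BoundedDoor.hasSPSPExpr_mono (hasSPSPExpr_of_comp hD1 hcomp) ?_ hDle
      (hD1.trans hDle) le_rfl
    calc (D + 1) * (B ^ c + D) ^ D ≤ B ^ (c + 1) * (B ^ (c + 2)) ^ D :=
          Nat.mul_le_mul hD1B (Nat.pow_le_pow_left hqD D)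
      _ = B ^ ((c + 1) + (c + 2) * D) := by rw [← pow_mul, ← pow_add]
      _ ≤ B ^ (c' * s + c') := Nat.pow_le_pow_right (by omega) hexp

/-- **The certified chain `Depth4HomFour ⟹ BoundedDoor ⟹ WidthDoor`** (at `K = ℂ` the hypothesis
is `Theses.Depth4.Depth4HomFour`, stmt 11333, verbatim): by name from
`Depth4BoundedDoor.boundedDoor_of_depth4HomFour`. [cite: Tavenas2015, §6] -/
theorem widthDoor_of_depth4HomFour (K : Type*) [CommSemiring K] [Nontrivial K]
    (h : ∀ c : ℕ, ∃ n : ℕ,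
      ((n + 2 : ℕ∞) ^ (c * Nat.sqrt n + c)) < homDepthFourCircuitSize (perPoly (Fin n) K)) :
    ∀ c : ℕ, ∃ n : ℕ, ¬ ∃ (Q : Fin ((n + 2) ^ c) → MvPolynomial (Fin n × Fin n) K)
        (F : MvPolynomial (Fin ((n + 2) ^ c)) K),
        (∀ i, (Q i).totalDegree ≤ Nat.sqrt n) ∧ F.totalDegree ≤ c * Nat.sqrt n + c ∧
          aeval Q F = perPoly (Fin n) K :=
  widthDoor_of_boundedDoor K (Depth4BoundedDoor.boundedDoor_of_depth4HomFour K h)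

end Summit.ValiantsHypothesis.ValiantsHypothesis.Theorems.Depth4WidthDoor
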